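import Mathlib
import Summits.RiemannHypothesis.RiemannHypothesis.Theorems.WeilFormatCJointShiftSOS
import HarnessLib

/-!
# The far-coercivity floor law: ORDER OF GROWTH from above, and the PNT kernel's edge state, in the kernel

Helper file (`--supports stmt-RiemannHypothesis-0098`, lead-track anchor: Weil-positivity window ladder, format-C far bound),
RH-free, pure proofs.  Seat rh-explicit-weil-1 gen8 (memo `run/shared/lean/pub/rh-explicit/rh-explicit-weil-1/FORMAT-K3.md` §9.9–9.10).
Companion of `WeilFarFloorGrowth` (lower growth `2aA ≥ (7/5)e^a − 12a + 11`).

§1 THE TRIVIAL FAR CONSTANT AND ITS SIZE.  Every window `[−a, a]` admits the uniform shift bound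
`Σ_{n<N} 2Λ(n)/√n ∫ f(x − log n) f(x) dx ≤ (Σ_{n<N} 2Λ(n)/√n) ∫ f²` (a shifted product integrates to at most `∫ f²`:
`2xy ≤ x² + y²` and translation invariance), and by Abel summation against Mathlib's Chebyshev bound `ψ(x) ≤ (log 4 + 4)x`
the weight sum is `Σ_{n<N} Λ(n)/√n ≤ 19√N`; with `N = ⌈e^{2a}⌉`: a far constant `A ≤ 38(e^a + 1)` always exists
(`shiftBound_range_trivial`).  With `far_constant_growth`: the far constant of the window ladder has exact exponential order `e^a`
up to a factor `a`, as kernel theorems uniform in the window.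
§2 THE PNT KERNEL'S EDGE STATE.  The floor law (STRUCTURE.md C-XIII, `WeilFarCoercivityFloor`: `λ_max(a) = L(a) − 2γ_E + ε(a)`) names
`L(a) = 1/(κ² − ¼)`, `κ·tanh(κa) = ½`, as «the top eigenvalue of the PNT kernel `e^{|x−y|/2}` on `[−a, a]`, eigenfunction `cosh κx`».
Here: `∫_{−a}^{a} e^{|x−y|/2} cosh(κy) dy` in closed form (`integral_exp_abs_half_mul_cosh`); under `κ·sinh(κa) = cosh(κa)/2`
(⟺ `κ tanh κa = ½`) `cosh(κ·)` IS an eigenfunction with eigenvalue `1/(κ² − ¼)` (`pnt_kernel_eigenfunction`); the eigenvalue in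
closed form `1/(κ² − ¼) = e^{2κa}/(κ + ½)²` (`inv_kappa_sq_sub_quarter_eq`) and `e^{a} ≤ L(a)` (`a ≥ 1`, `exp_le_inv_kappa_sq_sub_quarter`), `L(a) ≤ e^{a} + 4a` (`a ≥ 2`,
`inv_kappa_sq_sub_quarter_le`): the law's main term is `e^a + O(a)` by theorem.  Standard axioms only.
-/

set_option linter.dupNamespace false
set_option autoImplicit false

noncomputable section

open MeasureTheory Set Finset intervalIntegral
open scoped Real BigOperators ArithmeticFunction.vonMangoldt Chebyshev

namespace Summit.RiemannHypothesis.RiemannHypothesis.Theorems.WeilFormatC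

namespace FloorGrowth

/-! ## §1 The trivial far constant and its size -/

variable {a : ℝ}

/-! ### The trivial far constant -/

/-- A shifted product integrates to at most `∫ f²` (from `2xy ≤ x² + y²` and translation invariance). -/
theorem integral_shift_mul_le_integral_sq {f : ℝ → ℝ} (hf : Measurable f) {C : ℝ} (hC : ∀ x, |f x| ≤ C)
    (hsupp : ∀ x, x ∉ Icc (-a) a → f x = 0) (t : ℝ) :
    ∫ x, f (x - t) * f x ≤ ∫ x, f x ^ 2 := by
  have hI : ∀ u v : ℝ, Integrable (fun x ↦ f (x - u) * f (x - v)) := integrable_shift_mul_shift hf hC hsupp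
  have hm : Integrable (fun x ↦ f (x - t) * f x) :=
    (hI t 0).congr (Filter.Eventually.of_forall fun x ↦ by simp only [sub_zero])
  have h2 : Integrable (fun x ↦ f x ^ 2) :=
    (hI 0 0).congr (Filter.Eventually.of_forall fun x ↦ by simp only [sub_zero, pow_two])
  have h2t : Integrable (fun x ↦ f (x - t) ^ 2) :=
    (hI t t).congr (Filter.Eventually.of_forall fun x ↦ by simp only [pow_two])
  have hshift : ∫ x, f (x - t) ^ 2 = ∫ x, f x ^ 2 := integral_sub_right_eq_self (fun x ↦ f x ^ 2) t
  calc ∫ x, f (x - t) * f x ≤ ∫ x, (f (x - t) ^ 2 + f x ^ 2) / 2 :=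
        integral_mono hm ((h2t.add h2).div_const 2) fun x ↦ by
          have := sq_nonneg (f (x - t) - f x)
          simp only
          nlinarith
    _ = ((∫ x, f (x - t) ^ 2) + ∫ x, f x ^ 2) / 2 := by rw [MeasureTheory.integral_div, integral_add h2t h2]
    _ = ∫ x, f x ^ 2 := by rw [hshift]; ring

/-- **The trivial far constant** (range form): `Σ_{n<N} 2Λ(n)/√n ∫ f(x − log n) f(x) ≤ (Σ_{n<N} 2Λ(n)/√n)·∫f²`. -/
theorem shiftBound_range_weightSum {N : ℕ} {f : ℝ → ℝ} (hf : Measurable f) {C : ℝ} (hC : ∀ x, |f x| ≤ C)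
    (hsupp : ∀ x, x ∉ Icc (-a) a → f x = 0) :
    ∑ n ∈ Finset.range N, 2 * ((Λ n : ℝ) / Real.sqrt n) * (∫ x, f (x - Real.log n) * f x)
      ≤ (∑ n ∈ Finset.range N, 2 * ((Λ n : ℝ) / Real.sqrt n)) * ∫ x, f x ^ 2 := by
  rw [Finset.sum_mul]
  refine Finset.sum_le_sum fun n _ ↦ ?_
  have hw : 0 ≤ 2 * ((Λ n : ℝ) / Real.sqrt n) :=
    mul_nonneg (by norm_num) (div_nonneg ArithmeticFunction.vonMangoldt_nonneg (Real.sqrt_nonneg _))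
  exact mul_le_mul_of_nonneg_left (integral_shift_mul_le_integral_sq hf hC hsupp _) hw

/-! ### Size of the weight sum: Abel summation against Chebyshev's `ψ(x) ≤ (log 4 + 4)·x` -/

/-- Prefix sums of `Λ` over `range k` are at most `ψ(k) ≤ (log 4 + 4)·k`. -/
theorem sum_range_vonMangoldt_le (k : ℕ) : ∑ j ∈ Finset.range k, (Λ j : ℝ) ≤ (Real.log 4 + 4) * k := by
  have h1 : ∑ j ∈ Finset.range k, (Λ j : ℝ) ≤ ψ (k : ℝ) := by
    rw [Chebyshev.psi_eq_sum_Icc, Nat.floor_natCast]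
    refine Finset.sum_le_sum_of_subset_of_nonneg (fun j hj ↦ ?_) fun _ _ _ ↦ ArithmeticFunction.vonMangoldt_nonneg
    rw [Finset.mem_range] at hj; rw [Finset.mem_Icc]; omega
  exact h1.trans (Chebyshev.psi_le_const_mul_self (Nat.cast_nonneg k))

/-- One Abel step: for every `i`, `−(1/√(i+1) − 1/√i)·Σ_{j≤i} Λ(j) ≤ (log 4 + 4)·√2·(√(i+1) − √i)`
(at `i = 0` the prefix sum is `Λ(0) = 0`; for `i ≥ 1`, `(i+1)(1/√i − 1/√(i+1)) ≤ √2(√(i+1) − √i)`). -/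
theorem abel_step_le (i : ℕ) :
    -((1 / Real.sqrt ((i + 1 : ℕ) : ℝ) - 1 / Real.sqrt (i : ℝ)) * ∑ j ∈ Finset.range (i + 1), (Λ j : ℝ))
      ≤ (Real.log 4 + 4) * (Real.sqrt 2 * (Real.sqrt ((i + 1 : ℕ) : ℝ) - Real.sqrt (i : ℝ))) := by
  have hc : 0 ≤ Real.log 4 + 4 := by have := Real.log_nonneg (by norm_num : (1:ℝ) ≤ 4); linarith
  rcases Nat.eq_zero_or_pos i with rfl | hi
  · simp
    positivity
  · have hipos : (0 : ℝ) < i := by exact_mod_cast hi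
    set s := Real.sqrt (i : ℝ) with hs
    set s' := Real.sqrt ((i + 1 : ℕ) : ℝ) with hs'
    have hs0 : 0 < s := Real.sqrt_pos.2 hipos
    have hs1 : 1 ≤ s := by rw [hs, Real.le_sqrt (by norm_num) hipos.le]; exact_mod_cast hi
    have hss : s ^ 2 = i := Real.sq_sqrt hipos.le
    have hs's : s' ^ 2 = (i : ℝ) + 1 := by rw [hs', Real.sq_sqrt (by positivity)]; push_cast; ring
    have hs'pos : 0 < s' := by rw [hs']; exact Real.sqrt_pos.2 (by positivity)
    have hlt : s ≤ s' := by rw [hs, hs']; exact Real.sqrt_le_sqrt (by push_cast; linarith)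
    have h2 : Real.sqrt 2 ^ 2 = 2 := Real.sq_sqrt (by norm_num)
    have h2pos : 0 < Real.sqrt 2 := Real.sqrt_pos.2 (by norm_num)
    have hG := sum_range_vonMangoldt_le (i + 1)
    have hG0 : 0 ≤ ∑ j ∈ Finset.range (i + 1), (Λ j : ℝ) := Finset.sum_nonneg fun _ _ ↦ ArithmeticFunction.vonMangoldt_nonneg
    have hdiff : 0 ≤ 1 / s - 1 / s' := by
      rw [sub_nonneg]; exact one_div_le_one_div_of_le hs0 hlt
    have hkey : (1 / s - 1 / s') * (((i + 1 : ℕ) : ℝ)) ≤ Real.sqrt 2 * (s' - s) := by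
      have hi1 : (1 : ℝ) ≤ i := by exact_mod_cast hi
      have hs'le : s' ≤ Real.sqrt 2 * s := by
        rw [hs', hs, ← Real.sqrt_mul (by norm_num : (0:ℝ) ≤ 2)]
        exact Real.sqrt_le_sqrt (by push_cast; linarith)
      have heq : (1 / s - 1 / s') * (((i + 1 : ℕ) : ℝ)) = (s' - s) * (s' / s) := by
        push_cast; rw [← hs's]; field_simp
      rw [heq]
      have hsub : 0 ≤ s' - s := by linarith
      have hq : s' / s ≤ Real.sqrt 2 := by rw [div_le_iff₀ hs0]; exact hs'le
      calc (s' - s) * (s' / s) ≤ (s' - s) * Real.sqrt 2 := mul_le_mul_of_nonneg_left hq hsub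
        _ = Real.sqrt 2 * (s' - s) := by ring
    calc -((1 / s' - 1 / s) * ∑ j ∈ Finset.range (i + 1), (Λ j : ℝ))
        = (1 / s - 1 / s') * ∑ j ∈ Finset.range (i + 1), (Λ j : ℝ) := by ring
      _ ≤ (1 / s - 1 / s') * ((Real.log 4 + 4) * ((i + 1 : ℕ) : ℝ)) := mul_le_mul_of_nonneg_left hG hdiff
      _ = (Real.log 4 + 4) * ((1 / s - 1 / s') * ((i + 1 : ℕ) : ℝ)) := by ring
      _ ≤ (Real.log 4 + 4) * (Real.sqrt 2 * (s' - s)) := mul_le_mul_of_nonneg_left hkey hc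

/-- **The weight sum is `O(√N)`**: `Σ_{n<N} Λ(n)/√n ≤ 19·√N`. -/
theorem sum_vonMangoldt_div_sqrt_le (N : ℕ) :
    ∑ n ∈ Finset.range N, (Λ n : ℝ) / Real.sqrt n ≤ 19 * Real.sqrt N := by
  have hc : 0 ≤ Real.log 4 + 4 := by have := Real.log_nonneg (by norm_num : (1:ℝ) ≤ 4); linarith
  have hl4 : Real.log 4 < 14 / 10 := by
    have : Real.log 4 = 2 * Real.log 2 := by rw [show (4:ℝ) = 2 ^ 2 by norm_num, Real.log_pow]; norm_num
    rw [this]; linarith [Real.log_two_lt_d9]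
  rcases Nat.lt_or_ge N 2 with hN | hN
  · interval_cases N
    · simp
    · simp
  have hNpos : (0 : ℝ) < N := by exact_mod_cast (by omega : 0 < N)
  have hsqN : 0 < Real.sqrt N := Real.sqrt_pos.2 hNpos
  have hab := Finset.sum_range_by_parts (fun i : ℕ ↦ (1 / Real.sqrt (i : ℝ) : ℝ)) (fun i : ℕ ↦ (Λ i : ℝ)) N
  simp only [smul_eq_mul] at hab
  have hrw : ∑ n ∈ Finset.range N, (Λ n : ℝ) / Real.sqrt n = ∑ i ∈ Finset.range N, 1 / Real.sqrt (i : ℝ) * (Λ i : ℝ) := by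
    refine Finset.sum_congr rfl fun n _ ↦ ?_; ring
  rw [hrw, hab]
  have hN1 : ((N - 1 : ℕ) : ℝ) = (N : ℝ) - 1 := by push_cast [Nat.cast_sub (by omega : 1 ≤ N)]; ring
  have h2N : (2 : ℝ) ≤ N := by exact_mod_cast hN
  have hsq1 : 0 < Real.sqrt ((N - 1 : ℕ) : ℝ) := Real.sqrt_pos.2 (by rw [hN1]; linarith)
  have hA : 1 / Real.sqrt ((N - 1 : ℕ) : ℝ) * ∑ j ∈ Finset.range N, (Λ j : ℝ) ≤ 2 * (Real.log 4 + 4) * Real.sqrt N := by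
    have hG := sum_range_vonMangoldt_le N
    have h1 : 1 / Real.sqrt ((N - 1 : ℕ) : ℝ) * ∑ j ∈ Finset.range N, (Λ j : ℝ)
        ≤ 1 / Real.sqrt ((N - 1 : ℕ) : ℝ) * ((Real.log 4 + 4) * N) :=
      mul_le_mul_of_nonneg_left hG (by positivity)
    refine h1.trans ?_
    have hkey : (N : ℝ) ≤ 2 * Real.sqrt N * Real.sqrt ((N - 1 : ℕ) : ℝ) := by
      have hs : (Real.sqrt N * Real.sqrt ((N - 1 : ℕ) : ℝ)) ^ 2 = N * (N - 1) := by
        rw [mul_pow, Real.sq_sqrt hNpos.le, Real.sq_sqrt (by rw [hN1]; linarith), hN1]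
      nlinarith [hs, Real.sqrt_nonneg (N : ℝ), Real.sqrt_nonneg ((N - 1 : ℕ) : ℝ), mul_nonneg (Real.sqrt_nonneg (N:ℝ)) (Real.sqrt_nonneg ((N - 1 : ℕ) : ℝ))]
    rw [div_mul_eq_mul_div, one_mul, div_le_iff₀ hsq1]
    nlinarith [hkey, hc]
  have hB : -(∑ i ∈ Finset.range (N - 1), (1 / Real.sqrt (((i + 1 : ℕ) : ℝ)) - 1 / Real.sqrt (i : ℝ)) *
      ∑ j ∈ Finset.range (i + 1), (Λ j : ℝ)) ≤ (Real.log 4 + 4) * Real.sqrt 2 * Real.sqrt N := by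
    rw [← Finset.sum_neg_distrib]
    have hstep := fun i (_ : i ∈ Finset.range (N - 1)) ↦ abel_step_le i
    refine (Finset.sum_le_sum hstep).trans ?_
    rw [← Finset.mul_sum, ← Finset.mul_sum, Finset.sum_range_sub (fun i ↦ Real.sqrt (i : ℝ)) (N - 1)]
    simp only [Nat.cast_zero, Real.sqrt_zero, sub_zero]
    have hmono : Real.sqrt ((N - 1 : ℕ) : ℝ) ≤ Real.sqrt N := Real.sqrt_le_sqrt (by rw [hN1]; linarith)
    have h2 : 0 ≤ Real.sqrt 2 := Real.sqrt_nonneg 2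
    calc (Real.log 4 + 4) * (Real.sqrt 2 * Real.sqrt ((N - 1 : ℕ) : ℝ))
        ≤ (Real.log 4 + 4) * (Real.sqrt 2 * Real.sqrt N) :=
          mul_le_mul_of_nonneg_left (mul_le_mul_of_nonneg_left hmono h2) hc
      _ = (Real.log 4 + 4) * Real.sqrt 2 * Real.sqrt N := by ring
  have hs2 : Real.sqrt 2 < 3 / 2 := by
    rw [Real.sqrt_lt' (by norm_num)]; norm_num
  have hcs : (Real.log 4 + 4) * Real.sqrt 2 ≤ 81 / 10 := by nlinarith [Real.sqrt_nonneg 2]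
  have hA' : 2 * (Real.log 4 + 4) * Real.sqrt N ≤ (108 / 10) * Real.sqrt N :=
    mul_le_mul_of_nonneg_right (by linarith) hsqN.le
  have hB' : (Real.log 4 + 4) * Real.sqrt 2 * Real.sqrt N ≤ (81 / 10) * Real.sqrt N :=
    mul_le_mul_of_nonneg_right hcs hsqN.le
  linarith

/-- **A far constant of size `38(e^a + 1)` always exists**: for every window `[−a, a]` and `N = ⌈e^{2a}⌉`, the trivial bound is a
uniform shift bound with `Σ_{n<N} 2Λ(n)/√n ≤ 38·√N ≤ 38·(e^a + 1)`. -/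
theorem shiftBound_range_trivial {f : ℝ → ℝ} (hf : Measurable f) {C : ℝ} (hC : ∀ x, |f x| ≤ C)
    (hsupp : ∀ x, x ∉ Icc (-a) a → f x = 0) :
    ∑ n ∈ Finset.range ⌈Real.exp (2 * a)⌉₊, 2 * ((Λ n : ℝ) / Real.sqrt n) * (∫ x, f (x - Real.log n) * f x)
      ≤ 38 * (Real.exp a + 1) * ∫ x, f x ^ 2 := by
  set N := ⌈Real.exp (2 * a)⌉₊ with hN
  have h := shiftBound_range_weightSum (N := N) hf hC hsupp
  have hw : ∑ n ∈ Finset.range N, 2 * ((Λ n : ℝ) / Real.sqrt n) ≤ 38 * (Real.exp a + 1) := by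
    rw [← Finset.mul_sum]
    have hs := sum_vonMangoldt_div_sqrt_le N
    have hNle : (N : ℝ) ≤ Real.exp (2 * a) + 1 := by
      rw [hN]; exact (Nat.ceil_lt_add_one (Real.exp_pos _).le).le
    have hsq : Real.sqrt N ≤ Real.exp a + 1 := by
      rw [Real.sqrt_le_iff]
      refine ⟨by positivity, hNle.trans ?_⟩
      have h2a : Real.exp (2 * a) = Real.exp a ^ 2 := by rw [← Real.exp_nat_mul]; norm_num
      nlinarith [Real.exp_pos a]
    linarith
  have hE : 0 ≤ ∫ x, f x ^ 2 := integral_nonneg fun x ↦ sq_nonneg _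
  exact h.trans (mul_le_mul_of_nonneg_right hw hE)

/-! ## §2 The PNT kernel's edge state -/

section Eigen

/-- Left piece: on `y ≤ x`, an antiderivative of `e^{(x−y)/2} cosh(κy)` is `e^{(x−y)/2}(−cosh(κy)/2 − κ sinh(κy))/(¼ − κ²)`. -/
theorem hasDerivAt_left_piece (κ x y : ℝ) (hκ : (1 : ℝ) / 4 - κ ^ 2 ≠ 0) :
    HasDerivAt (fun y ↦ Real.exp ((x - y) / 2) * (-Real.cosh (κ * y) / 2 - κ * Real.sinh (κ * y)) / (1 / 4 - κ ^ 2))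
      (Real.exp ((x - y) / 2) * Real.cosh (κ * y)) y := by
  have h1 : HasDerivAt (fun y ↦ (x - y) / 2) (-(1 : ℝ) / 2) y := ((hasDerivAt_id' y).const_sub x).div_const 2
  have he := h1.exp
  have hk : HasDerivAt (fun y ↦ κ * y) κ y := by simpa using (hasDerivAt_id' y).const_mul κ
  have hc := hk.cosh
  have hs := hk.sinh
  have hg : HasDerivAt (fun y ↦ -Real.cosh (κ * y) / 2 - κ * Real.sinh (κ * y))
      (-(Real.sinh (κ * y) * κ) / 2 - κ * (Real.cosh (κ * y) * κ)) y :=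
    ((hc.neg).div_const 2).sub (hs.const_mul κ)
  have hprod := (he.mul hg).div_const (1 / 4 - κ ^ 2)
  refine hprod.congr_deriv ?_
  rw [div_eq_iff hκ]
  ring

/-- Right piece: on `x ≤ y`, an antiderivative of `e^{(y−x)/2} cosh(κy)` is `e^{(y−x)/2}(cosh(κy)/2 − κ sinh(κy))/(¼ − κ²)`. -/
theorem hasDerivAt_right_piece (κ x y : ℝ) (hκ : (1 : ℝ) / 4 - κ ^ 2 ≠ 0) :
    HasDerivAt (fun y ↦ Real.exp ((y - x) / 2) * (Real.cosh (κ * y) / 2 - κ * Real.sinh (κ * y)) / (1 / 4 - κ ^ 2))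
      (Real.exp ((y - x) / 2) * Real.cosh (κ * y)) y := by
  have h1 : HasDerivAt (fun y ↦ (y - x) / 2) ((1 : ℝ) / 2) y := ((hasDerivAt_id' y).sub_const x).div_const 2
  have he := h1.exp
  have hk : HasDerivAt (fun y ↦ κ * y) κ y := by simpa using (hasDerivAt_id' y).const_mul κ
  have hc := hk.cosh
  have hs := hk.sinh
  have hg : HasDerivAt (fun y ↦ Real.cosh (κ * y) / 2 - κ * Real.sinh (κ * y))
      ((Real.sinh (κ * y) * κ) / 2 - κ * (Real.cosh (κ * y) * κ)) y :=
    (hc.div_const 2).sub (hs.const_mul κ)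
  have hprod := (he.mul hg).div_const (1 / 4 - κ ^ 2)
  refine hprod.congr_deriv ?_
  rw [div_eq_iff hκ]
  ring

/-- **The PNT kernel applied to `cosh(κ·)`** (closed form): for `κ² ≠ ¼`, `−a ≤ x ≤ a`,
`∫_{−a}^{a} e^{|x−y|/2} cosh(κy) dy = (−cosh κx + (cosh(κa)/2 − κ sinh(κa))(e^{(x+a)/2} + e^{(a−x)/2}))/(¼ − κ²)`. -/
theorem integral_exp_abs_half_mul_cosh {κ a x : ℝ} (hκ : (1 : ℝ) / 4 - κ ^ 2 ≠ 0) (hx : x ∈ Icc (-a) a) :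
    ∫ y in (-a)..a, Real.exp (|x - y| / 2) * Real.cosh (κ * y) =
      (-Real.cosh (κ * x) + (Real.cosh (κ * a) / 2 - κ * Real.sinh (κ * a)) *
        (Real.exp ((x + a) / 2) + Real.exp ((a - x) / 2))) / (1 / 4 - κ ^ 2) := by
  have hcont : Continuous fun y ↦ Real.exp (|x - y| / 2) * Real.cosh (κ * y) := by fun_prop
  have hint : ∀ u v : ℝ, IntervalIntegrable (fun y ↦ Real.exp (|x - y| / 2) * Real.cosh (κ * y)) volume u v :=
    fun u v ↦ hcont.intervalIntegrable u v
  rw [← integral_add_adjacent_intervals (hint (-a) x) (hint x a)]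
  have hL : ∫ y in (-a)..x, Real.exp (|x - y| / 2) * Real.cosh (κ * y)
      = ∫ y in (-a)..x, Real.exp ((x - y) / 2) * Real.cosh (κ * y) := by
    refine integral_congr fun y hy ↦ ?_
    rw [uIcc_of_le hx.1] at hy
    simp only [abs_of_nonneg (show 0 ≤ x - y by linarith [hy.2])]
  have hR : ∫ y in x..a, Real.exp (|x - y| / 2) * Real.cosh (κ * y)
      = ∫ y in x..a, Real.exp ((y - x) / 2) * Real.cosh (κ * y) := by
    refine integral_congr fun y hy ↦ ?_
    rw [uIcc_of_le hx.2] at hy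
    simp only [abs_of_nonpos (show x - y ≤ 0 by linarith [hy.1]), neg_sub]
  rw [hL, hR]
  rw [integral_eq_sub_of_hasDerivAt (fun y _ ↦ hasDerivAt_left_piece κ x y hκ)
      ((by fun_prop : Continuous fun y ↦ Real.exp ((x - y) / 2) * Real.cosh (κ * y)).intervalIntegrable _ _),
    integral_eq_sub_of_hasDerivAt (fun y _ ↦ hasDerivAt_right_piece κ x y hκ)
      ((by fun_prop : Continuous fun y ↦ Real.exp ((y - x) / 2) * Real.cosh (κ * y)).intervalIntegrable _ _)]
  simp only [sub_self, zero_div, Real.exp_zero, one_mul, Real.cosh_neg, Real.sinh_neg, mul_neg]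
  have e1 : (x - -a) / 2 = (x + a) / 2 := by ring
  rw [e1]
  field_simp
  ring

/-- **`cosh(κ·)` is an eigenfunction of the PNT kernel `e^{|x−y|/2}` on `[−a, a]` with eigenvalue `1/(κ² − ¼)`**
whenever `κ·sinh(κa) = cosh(κa)/2` (i.e. `κ·tanh(κa) = ½`, the condition defining `pntKappa`/`pntFloor` of C-XIII). -/
theorem pnt_kernel_eigenfunction {κ a x : ℝ} (hκ : κ ^ 2 ≠ 1 / 4) (heig : κ * Real.sinh (κ * a) = Real.cosh (κ * a) / 2)
    (hx : x ∈ Icc (-a) a) :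
    ∫ y in (-a)..a, Real.exp (|x - y| / 2) * Real.cosh (κ * y) = Real.cosh (κ * x) / (κ ^ 2 - 1 / 4) := by
  have hκ' : (1 : ℝ) / 4 - κ ^ 2 ≠ 0 := fun h ↦ hκ (by linarith)
  rw [integral_exp_abs_half_mul_cosh hκ' hx]
  have hz : Real.cosh (κ * a) / 2 - κ * Real.sinh (κ * a) = 0 := by linarith
  rw [hz, zero_mul, add_zero]
  have hκ'' : κ ^ 2 - 1 / 4 ≠ 0 := fun h ↦ hκ (by linarith)
  rw [div_eq_div_iff hκ' hκ'']
  ring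

/-! ### The eigenvalue in closed form: `1/(κ² − ¼) = e^{2κa}/(κ + ½)²`, hence `L(a) ≥ e^{a}` -/

/-- Under the eigen-condition `κ·sinh(κa) = cosh(κa)/2` with `κ > ½`: `κ − ½ = (κ + ½)·e^{−2κa}`. -/
theorem kappa_sub_half_eq {κ a : ℝ} (heig : κ * Real.sinh (κ * a) = Real.cosh (κ * a) / 2) :
    κ - 1 / 2 = (κ + 1 / 2) * Real.exp (-(2 * (κ * a))) := by
  rw [Real.sinh_eq, Real.cosh_eq] at heig
  have hpos : 0 < Real.exp (κ * a) := Real.exp_pos _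
  have hneg : Real.exp (-(κ * a)) = (Real.exp (κ * a))⁻¹ := Real.exp_neg _
  have h2 : Real.exp (-(2 * (κ * a))) = (Real.exp (κ * a))⁻¹ ^ 2 := by
    rw [← Real.exp_neg, ← Real.exp_nat_mul]; congr 1; push_cast; ring
  rw [h2]
  rw [hneg] at heig
  field_simp at heig ⊢
  nlinarith [heig, hpos]

/-- **The top eigenvalue in closed form**: `κ > ½`, `κ·sinh(κa) = cosh(κa)/2` ⇒ `1/(κ² − ¼) = e^{2κa}/(κ + ½)²`. -/
theorem inv_kappa_sq_sub_quarter_eq {κ a : ℝ} (hκ : 1 / 2 < κ) (heig : κ * Real.sinh (κ * a) = Real.cosh (κ * a) / 2) :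
    1 / (κ ^ 2 - 1 / 4) = Real.exp (2 * (κ * a)) / (κ + 1 / 2) ^ 2 := by
  have h := kappa_sub_half_eq heig
  set E := Real.exp (2 * (κ * a)) with hE
  have hEpos : 0 < E := Real.exp_pos _
  have hinv : Real.exp (-(2 * (κ * a))) = E⁻¹ := by rw [hE, Real.exp_neg]
  rw [hinv] at h
  have hk : 0 < κ + 1 / 2 := by linarith
  have hfac : κ ^ 2 - 1 / 4 = (κ + 1 / 2) ^ 2 * E⁻¹ := by
    calc κ ^ 2 - 1 / 4 = (κ - 1 / 2) * (κ + 1 / 2) := by ring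
      _ = (κ + 1 / 2) * E⁻¹ * (κ + 1 / 2) := by rw [h]
      _ = (κ + 1 / 2) ^ 2 * E⁻¹ := by ring
  rw [hfac]
  field_simp

/-- **`L(a) ≥ e^{a}`**: for `a ≥ 1`, `κ > ½` and the eigen-condition, `e^{a} ≤ 1/(κ² − ¼)` (with `δ = κ − ½`:
`1/(κ² − ¼) = e^{a}·e^{2δa}/(1 + δ)²` and `e^{δa} ≥ 1 + δa ≥ 1 + δ`). -/
theorem exp_le_inv_kappa_sq_sub_quarter {κ a : ℝ} (ha : 1 ≤ a) (hκ : 1 / 2 < κ)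
    (heig : κ * Real.sinh (κ * a) = Real.cosh (κ * a) / 2) :
    Real.exp a ≤ 1 / (κ ^ 2 - 1 / 4) := by
  rw [inv_kappa_sq_sub_quarter_eq hκ heig]
  set δ := κ - 1 / 2 with hδ
  have hδpos : 0 < δ := by rw [hδ]; linarith
  have hk : κ + 1 / 2 = 1 + δ := by rw [hδ]; ring
  have hsplit : Real.exp (2 * (κ * a)) = Real.exp a * Real.exp (δ * a) ^ 2 := by
    rw [← Real.exp_nat_mul, ← Real.exp_add]; congr 1; rw [hδ]; push_cast; ring
  have hlin : 1 + δ ≤ Real.exp (δ * a) := by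
    have h1 : δ * a + 1 ≤ Real.exp (δ * a) := Real.add_one_le_exp (δ * a)
    nlinarith
  have hsq : (1 + δ) ^ 2 ≤ Real.exp (δ * a) ^ 2 := by nlinarith [hlin, hδpos]
  rw [hsplit, hk, le_div_iff₀ (by positivity)]
  nlinarith [Real.exp_pos a, hsq]

/-- **`L(a) ≤ e^{a} + 4a`** for `a ≥ 2` (with `exp_le_inv_kappa_sq_sub_quarter`: the floor law's main term is `e^a + O(a)` by theorem;
numerically `L = e^a + 2a − 1 + O(a²e^{−a})`).  Proof: `δ = κ − ½ = q/(1 − q)` with `q = e^{−2κa} ≤ e^{−a}`, so `2δa ≤ 2.32·a·e^{−a} ≤ 0.63`,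
and `e^x ≤ 1 + x + x²` for `|x| ≤ 1`. -/
theorem inv_kappa_sq_sub_quarter_le {κ a : ℝ} (ha : 2 ≤ a) (hκ : 1 / 2 < κ)
    (heig : κ * Real.sinh (κ * a) = Real.cosh (κ * a) / 2) :
    1 / (κ ^ 2 - 1 / 4) ≤ Real.exp a + 4 * a := by
  rw [inv_kappa_sq_sub_quarter_eq hκ heig]
  have h := kappa_sub_half_eq heig
  set δ := κ - 1 / 2 with hδ
  set q := Real.exp (-(2 * (κ * a))) with hq
  have hδpos : 0 < δ := by rw [hδ]; linarith
  have hk : κ + 1 / 2 = 1 + δ := by rw [hδ]; ring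
  rw [hk] at h
  -- q ≤ e^{−a} ≤ e^{−2}
  have hqa : q ≤ Real.exp (-a) := Real.exp_le_exp.2 (by nlinarith)
  have hea : Real.exp (-a) ≤ Real.exp (-2) := Real.exp_le_exp.2 (by linarith)
  have he2 : Real.exp (-2) ≤ 1354 / 10000 := by
    have : Real.exp (-2) = Real.exp (-1) ^ 2 := by rw [← Real.exp_nat_mul]; norm_num
    rw [this]; nlinarith [Real.exp_neg_one_lt_d9, Real.exp_pos (-1 : ℝ)]
  have hq0 : 0 < q := Real.exp_pos _
  -- δ = q (1 + δ) ⇒ δ ≤ 1.157 q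
  have hδq : δ ≤ (1157 / 1000) * q := by nlinarith
  -- a e^{−a} ≤ 2 e^{−2}  (a ≥ 2)
  have hae : a * Real.exp (-a) ≤ 2 * Real.exp (-2) := by
    have h1 : a - 2 + 1 ≤ Real.exp (a - 2) := Real.add_one_le_exp (a - 2)
    have h3 : a ≤ 2 * Real.exp (a - 2) := by nlinarith [Real.exp_pos (a - 2)]
    have hsplit : Real.exp (-2) = Real.exp (a - 2) * Real.exp (-a) := by rw [← Real.exp_add]; ring_nf
    rw [hsplit]; nlinarith [Real.exp_pos (-a), Real.exp_pos (a - 2)]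
  -- x := 2 δ a ∈ [0, 0.63]
  have hx0 : 0 ≤ 2 * δ * a := by positivity
  have hx1 : 2 * δ * a ≤ 627 / 1000 := by nlinarith
  have hexp : Real.exp (2 * δ * a) ≤ 1 + 2 * δ * a + (2 * δ * a) ^ 2 := by
    have := Real.abs_exp_sub_one_sub_id_le (x := 2 * δ * a) (by rw [abs_of_nonneg hx0]; linarith)
    have := (abs_le.1 this).2
    linarith
  have hsplit : Real.exp (2 * (κ * a)) = Real.exp a * Real.exp (2 * δ * a) := by
    rw [← Real.exp_add]; congr 1; rw [hδ]; ring
  rw [hsplit, div_le_iff₀ (by positivity)]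
  -- e^a e^{x} ≤ e^a (1 + x + x²) = e^a + (e^a x)(1 + x) ≤ e^a + 2.314a·1.627 ≤ (e^a + 4a)·1 ≤ (e^a + 4a)(κ + ½)²
  have hEpos : 0 < Real.exp a := Real.exp_pos a
  have hEinv : Real.exp a * Real.exp (-a) = 1 := by rw [← Real.exp_add]; simp
  have hxE : Real.exp a * (2 * δ * a) ≤ (2314 / 1000) * a := by
    have h1 : Real.exp a * δ ≤ Real.exp a * ((1157 / 1000) * q) := mul_le_mul_of_nonneg_left hδq hEpos.le
    have h2 : Real.exp a * q ≤ Real.exp a * Real.exp (-a) := mul_le_mul_of_nonneg_left hqa hEpos.le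
    rw [hEinv] at h2
    nlinarith
  have h1 : Real.exp a * Real.exp (2 * δ * a) ≤ Real.exp a * (1 + 2 * δ * a + (2 * δ * a) ^ 2) :=
    mul_le_mul_of_nonneg_left hexp hEpos.le
  have h2 : Real.exp a * (1 + 2 * δ * a + (2 * δ * a) ^ 2) = Real.exp a + (Real.exp a * (2 * δ * a)) * (1 + 2 * δ * a) := by
    ring
  have h3 : (Real.exp a * (2 * δ * a)) * (1 + 2 * δ * a) ≤ ((2314 / 1000) * a) * (1627 / 1000) :=
    mul_le_mul hxE (by linarith) (by positivity) (by positivity)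
  have h4 : 1 ≤ (κ + 1 / 2) ^ 2 := by rw [hk]; nlinarith
  have h5 : 0 ≤ Real.exp a + 4 * a := by positivity
  calc Real.exp a * Real.exp (2 * δ * a) ≤ Real.exp a + 4 * a := by nlinarith [h1, h2, h3]
    _ = (Real.exp a + 4 * a) * 1 := by ring
    _ ≤ (Real.exp a + 4 * a) * (κ + 1 / 2) ^ 2 := mul_le_mul_of_nonneg_left h4 h5

end Eigen

end FloorGrowth

end Summit.RiemannHypothesis.RiemannHypothesis.Theorems.WeilFormatC
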